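import Summits.NavierStokesRegularity.FluidComputer.GateBudgetColdOutput
import HarnessLib

/-!
# What no tuning can beat, part 43: THE DRAIN EMPTIES THE TRANSFER MODE INTO THE OUTPUT —
# under a capped trigger `d(t)² ≤ 1/(K²(t - T)²) + 2(c₁/ρ²)H`: every tooth's firing completes
# within `1/K²`, and between two pulses the only memory a member keeps is its monotone output

Cell `pub-fluidc`, blueprint seat bp1 (gen 33, third item); same namespace and conventions as
parts 1–42 (`GateBudget*.lean`); imports part 40 (`GateBudgetColdOutput`: the output pair frozen
under a capped trigger, and through it parts 39 `GateBudgetColdWindow`, 38 `GateBudgetSharpRefire`,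
26 `GateBudgetRiccati`). Modes `0 = a` carrier, `1 = b` clock, `2 = c` trigger, `3 = d` transfer,
`4 = ã` output; `t₋ = √(2 - 24 log K/K¹⁰)`, `t₊ = √(2 + 2/K¹⁰) + 242/K⁹`.
HONEST FRAMING (verbatim): low prior, high value-of-information experiment on Tao's machine
paradigm; NOT a claim that NS blows up.

THE POINT (SPEC-INPUT-bp1 §AO item (19b′)). Parts 41–42 follow a lattice dud through its second
pulse and lose, per pulse, the bookkeeping term `|d(r₁)| ≤ √(1 - a(r₁)²) ≤ 0.0837`: the transfer
mode at the re-light time was bounded by the energy identity alone. But on a window `[T, T + H]`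
where the trigger is capped, `c ≤ c₁`, the output pair is frozen (part 40 §121: `|d² + ã² - E| ≤
(c₁/ρ²)(t - T) ≤ δ`, `E = d(T)² + ã(T)²`, `δ = (c₁/ρ²)H`) while the drain `∂ₜã = Kd²` runs on
its own, and part 26's Riccati floor — `ã(t) ≥ √m·tanh(K√m(t - T))` as long as `d² + ã² ≥ m`,
here with `m = E - δ` — leaves for the transfer mode only `d² ≤ E + δ - m·tanh² =
m·sech²(K√m(t - T)) + 2δ`, and `m·sech²(K√m·s) ≤ m/(1 + K²m·s²) ≤ 1/(K²s²)` WHATEVER THE LEVEL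
`m` (`cosh y ≥ sinh y ≥ y`; `riccati_floor_decay`), the OUTPUT receiving the rest, `ã² ≥ E - δ -
d²`. §128 `knob_drain_empties_transfer`: `d(t)² ≤ 1/(K²(t - T)²) + 2(c₁/ρ²)H` and `ã(t)² ≥ E -
1/(K²(t - T)²) - 3(c₁/ρ²)H` for `T < t ≤ T + H`, for ANY knob circuit (`K > 0`, `ρ > 0`, any `M`,
`ε`, `T ≥ 0`), with no hypothesis on the level (`E ≤ δ` is the trivial case). §129 puts it on
part 39's universal cold window (`c < ρ²/K⁹` on `[T, T + 2.8282]`, `T ≤ t₊`, `|d(T)| ≥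
0.99755|sin wπ| - 0.07|cos wπ| - 10⁻³`, §115): for EVERY member `w` and every `t₊ < t ≤ t₋ +
2.8282`, `d(t)² ≤ 1/(K²(t - t₊)²) + 6/K⁹` and `ã(t)² ≥ max(0.99755|sin wπ| - 0.07|cos wπ| - 10⁻³,
0)² - 1/(K²(t - t₊)²) - 9/K⁹` (`knob_member_transfer_empties`) — one time unit after `t₊` every
member's transfer mode holds at most `1/K² + 6/K⁹` of the energy, and EVERY tooth, pinned or
not, however weak, has fired to within `1/K²` of its frozen pair (part 34's pinned floor
`√m·tanh(K√m/8)` stalls for weak teeth). §130 reads §128 at the re-light time of a lattice dud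
(part 38: `c ≤ 2ρ²/K¹⁰ ≤ ρ²/K⁹` on `[T, t_z]`, `c ≤ ρ²/K⁹` on `[t_z, r₁]`, `2.8282 < r₁ - T <
2.8542`): `d(r₁)² ≤ 1/(7K²) + 6/K⁹` next to part 38's thirteen facts, verbatim
(`knob_dud_relights_empty`) — the entry datum that turns §127's `|d(T₂)| ≤ 0.07|a(r₁)| + |d(r₁)|
+ 10⁻⁶` into `≤ 0.07 + 0.378/K + 10⁻⁵`.

READING. Between two pulses the drain does not merely freeze the output pair, it SORTS it: the
transfer mode is poured into the output at the universal rate `|d(t)| ≤ 1/(K(t - T))`, so (a)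
the firing of every tooth COMPLETES — `ã² → d(T)² + ã(T)²` within `1/(K²s²)`, with no pin and no
level hypothesis — and (b) the only memory a member carries from one pulse to the next is its
monotone output `ã`; a lattice dud re-enters its second pulse as it entered its first, up to
`ã(r₁)² ≤ 7/1000` and `1/(7K²)`.
HONEST LIMITS. (i) Level-free and therefore slow: the true emptying rate is `≈ K√m`
(exponential), the `1/(K²s²)` form pays `sech² y ≤ 1/(1 + y²)` for not knowing `m`; the output
floor inherits part 39's `0.07|cos wπ|` slop, so it is void for `|sin wπ| ≲ 0.071`; (ii) §130
does not re-prove §126–§127 with the new entry datum — that is a re-run of parts 41–42 with one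
more conjunct threaded through (successor); (iii) the output `ã` is NOT reset — it only grows —
so the per-pulse leak into `ã` still accumulates; (iv) `M = K¹⁰`, `K ≥ 16`, window `200ε/K²⁰ ≤ ρ²
≤ 2ε/K¹⁰`, `ε² ≤ 1/(6K²⁰)` in §129–§130 (§128 is for any knob circuit); (v) nothing about
Navier–Stokes.
[cite: Tao2016AveragedNS, §5.5 Theorem 5.3, (5.5), (5.6), (dora), (ta-eq), (tcable), (energy-con)]
-/

noncomputable section

namespace Summit.NavierStokesRegularity.FluidComputer.GateBudget

open Real Set Filter Topology
open Literature.Analysis.FluidPDE.Tao2016AveragedNS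

variable {K ε ρ : ℝ} {X : ℝ → Fin 5 → ℝ} {C : ℝ → ℝ}

/-! ## §128 The drain empties the transfer mode under a capped trigger (any knob circuit) -/

/-- **The level-free decay of the Riccati floor.** `K > 0`, `m > 0`, `s > 0`:
`m - m·tanh²(K√m·s) ≤ 1/(K²s²)` — `1 - tanh² = 1/cosh²` and `cosh² y = 1 + sinh² y ≥ y² = K²m·s²`
(`sinh y ≥ y ≥ 0`): the complement of Tao's switching profile `√m·tanh(K√m·s)` inside the level
`m` decays like `1/(K²s²)` uniformly in the level. [cite: Tao2016AveragedNS, §5.5 (tcable)] -/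
theorem riccati_floor_decay {m s : ℝ} (hK : 0 < K) (hm : 0 < m) (hs : 0 < s) :
    m - m * tanh (K * √m * s) ^ 2 ≤ 1 / (K ^ 2 * s ^ 2) := by
  set y := K * √m * s with hy
  have hy0 : 0 ≤ y := mul_nonneg (mul_nonneg hK.le (sqrt_nonneg m)) hs.le
  have hc2 : cosh y ^ 2 ≠ 0 := by positivity
  have hys : y ^ 2 ≤ sinh y ^ 2 := pow_le_pow_left₀ hy0 (Real.self_le_sinh_iff.2 hy0) 2
  have hy2 : y ^ 2 = K ^ 2 * s ^ 2 * m := by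
    rw [hy, mul_pow, mul_pow, sq_sqrt hm.le]; ring
  have hkey : m - m * tanh y ^ 2 = m / cosh y ^ 2 := by
    rw [tanh_eq_sinh_div_cosh, div_pow, eq_div_iff hc2, sub_mul, mul_assoc,
      div_mul_cancel₀ _ hc2]
    linear_combination m * cosh_sq' y
  rw [hkey, div_le_div_iff₀ (by positivity) (by positivity), one_mul]
  nlinarith [hys, hy2, cosh_sq' y, hm.le]

/-- **THE DRAIN EMPTIES THE TRANSFER MODE.** Any `rotorCircuit K M ε ρ` (`K > 0`, `ρ > 0`, any
`M`, `ε`), the trajectory from (5.6), `T ≥ 0`, `0 ≤ c₁` and `c ≤ c₁` on `[T, T + H]`: for every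
`t ∈ (T, T + H]`, `d(t)² ≤ 1/(K²(t - T)²) + 2(c₁/ρ²)H` and `ã(t)² ≥ d(T)² + ã(T)² - 1/(K²(t - T)²)
- 3(c₁/ρ²)H`. With `E = d(T)² + ã(T)²` and `δ =
(c₁/ρ²)H`, part 40's `knob_output_frozen` gives `|d² + ã² - E| ≤ δ` on the window; if `E ≤ δ`
then `d² ≤ E + δ ≤ 2δ`; else part 26's `knob_drain_riccati` at the level `m = E - δ > 0` (`ã(T) ≥
0` by (5.6)) gives `ã(t) ≥ √m·tanh(K√m(t - T)) ≥ 0`, so `d(t)² ≤ E + δ - m·tanh² = (m - m·tanh²)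
+ 2δ ≤ 1/(K²(t - T)²) + 2δ` by `riccati_floor_decay`; and the OUTPUT receives the rest: `ã(t)² =
(d² + ã²) - d² ≥ E - 1/(K²(t - T)²) - 3δ`.
[cite: Tao2016AveragedNS, §5.5 (5.5), (5.6), (dora), (ta-eq), (tcable), (energy-con)] -/
theorem knob_drain_empties_transfer {M : ℝ}
    (hX : ∀ t, HasDerivAt X (RotorKnob.rotorCircuit K M ε ρ (X t)) t)
    (h0 : X 0 = delayInit) (hK : 0 < K) (hρ : 0 < ρ) {T H c₁ : ℝ} (hT : 0 ≤ T) (hc₁ : 0 ≤ c₁)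
    (hc : ∀ r ∈ Icc T (T + H), X r 2 ≤ c₁) {t : ℝ} (ht : t ∈ Icc T (T + H)) (hTt : T < t) :
    X t 3 ^ 2 ≤ 1 / (K ^ 2 * (t - T) ^ 2) + 2 * (c₁ / ρ ^ 2 * H) ∧
      X T 3 ^ 2 + X T 4 ^ 2 - 1 / (K ^ 2 * (t - T) ^ 2) - 3 * (c₁ / ρ ^ 2 * H) ≤ X t 4 ^ 2 := by
  have hfr := knob_output_frozen hX h0 hρ hT hc
  have hδ0 : 0 ≤ c₁ / ρ ^ 2 := by positivity
  have hdrift : ∀ r ∈ Icc T (T + H),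
      |X r 3 ^ 2 + X r 4 ^ 2 - (X T 3 ^ 2 + X T 4 ^ 2)| ≤ c₁ / ρ ^ 2 * H := fun r hr =>
    (hfr r hr).trans (mul_le_mul_of_nonneg_left (by linarith only [hr.2]) hδ0)
  have hQ : 0 ≤ 1 / (K ^ 2 * (t - T) ^ 2) := by positivity
  obtain ⟨htlo, hthi⟩ := abs_le.1 (hdrift t ht)
  have hd3 : X t 3 ^ 2 ≤ 1 / (K ^ 2 * (t - T) ^ 2) + 2 * (c₁ / ρ ^ 2 * H) := by
    by_cases hm : X T 3 ^ 2 + X T 4 ^ 2 - c₁ / ρ ^ 2 * H ≤ 0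
    · linarith only [sq_nonneg (X t 4), hthi, hQ, hm]
    rw [not_le] at hm
    set m := X T 3 ^ 2 + X T 4 ^ 2 - c₁ / ρ ^ 2 * H with hmdef
    have hfloor : √m * tanh (K * √m * (t - T)) ≤ X t 4 :=
      knob_drain_riccati hX hK.le hm (RotorKnob.e_nonneg hX h0 hK.le hT)
        (fun r hr => by
          obtain ⟨hlo, -⟩ := abs_le.1 (hdrift r hr)
          linarith only [hlo, hmdef]) ht
    have hs : 0 < t - T := sub_pos.2 hTt
    have hy0 : 0 ≤ K * √m * (t - T) := mul_nonneg (mul_nonneg hK.le (sqrt_nonneg m)) hs.le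
    have hth0 : 0 ≤ tanh (K * √m * (t - T)) := by
      rw [tanh_eq_sinh_div_cosh]
      exact div_nonneg (Real.sinh_nonneg_iff.2 hy0) (cosh_pos _).le
    have hsq : m * tanh (K * √m * (t - T)) ^ 2 ≤ X t 4 ^ 2 := by
      have h := pow_le_pow_left₀ (mul_nonneg (sqrt_nonneg m) hth0) hfloor 2
      rwa [mul_pow, sq_sqrt hm.le] at h
    have hdec := riccati_floor_decay hK hm hs
    linarith only [hthi, hsq, hdec, hmdef]
  exact ⟨hd3, by linarith only [hd3, htlo]⟩

/-! ## §129 Every member's transfer mode is emptied into its output on the cold window -/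

/-- **EVERY MEMBER'S TRANSFER MODE IS EMPTIED INTO ITS OUTPUT ON THE COLD WINDOW.** `K ≥ 16`,
`0 < ε`, `ε² ≤ 1/(6K²⁰)`, an exact trajectory of `rotorCircuit K K¹⁰ ε ρ` from (5.6) with
`200ε/K²⁰ ≤ ρ² ≤ 2ε/K¹⁰` (ANY member `w = ε/(K¹⁰ρ²)`, no lattice condition, no pin): for every
`t` with `t₊ < t ≤ t₋ + 2.8282`, `d(t)² ≤ 1/(K²(t - t₊)²) + 6/K⁹` and `ã(t)² ≥ max(0.99755|sin wπ|
- 0.07|cos wπ| - 10⁻³, 0)² - 1/(K²(t - t₊)²) - 9/K⁹` — §128 on part 39's cold window `[T, T +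
2.8282] ∋ t` (`T ≤ t₊ < t`, `c < ρ²/K⁹` there, and the lower bracket of `|d(T)|`; §115
`knob_member_doused_cold`) with `c₁ = ρ²/K⁹`, `(c₁/ρ²)·2.8282 ≤ 3/K⁹`, `t - T ≥ t - t₊`. One
time unit after `t₊` at most `1/K² + 6/K⁹` of the energy sits in the transfer mode of ANY
member, and the output of EVERY tooth — pinned or not, however weak — has reached its frozen
pair up to `1/K²`: part 34's floor `√m·tanh(K√m/8)` needs the pin and stalls for weak teeth at
window `1/8`; this one completes.
[cite: Tao2016AveragedNS, §5.5 Theorem 5.3, (5.5), (5.6), (dora), (ta-eq), (tcable)] -/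
theorem knob_member_transfer_empties
    (hX : ∀ t, HasDerivAt X (RotorKnob.rotorCircuit K (K ^ 10) ε ρ (X t)) t)
    (h0 : X 0 = delayInit) (hC : ∀ t, HasDerivAt C (X t 2) t) (hK : 16 ≤ K) (hε : 0 < ε)
    (hεK : ε ^ 2 ≤ 1 / (6 * K ^ 20)) (hρ : 0 < ρ) (hlo : 200 * ε / K ^ 20 ≤ ρ ^ 2)
    (hhi : K ^ 10 * ρ ^ 2 ≤ 2 * ε) :
    ∀ t ∈ Icc (√(2 + 2 / K ^ 10) + 242 / K ^ 9)
        (√(2 - 24 * Real.log K / K ^ 10) + 28282 / 10000),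
      √(2 + 2 / K ^ 10) + 242 / K ^ 9 < t →
        X t 3 ^ 2 ≤ 1 / (K ^ 2 * (t - (√(2 + 2 / K ^ 10) + 242 / K ^ 9)) ^ 2) + 6 / K ^ 9 ∧
        max (19951 / 20000 * |sin (ε / (K ^ 10 * ρ ^ 2) * π)|
              - 7 / 100 * |cos (ε / (K ^ 10 * ρ ^ 2) * π)| - 1 / 1000) 0 ^ 2
            - 1 / (K ^ 2 * (t - (√(2 + 2 / K ^ 10) + 242 / K ^ 9)) ^ 2) - 9 / K ^ 9
          ≤ X t 4 ^ 2 := by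
  have hK0 : 0 < K := by linarith
  obtain ⟨s₀, T, -, -, hs1, -, hsT, -, hlow, hTt, -, -, -, -, -, -, hd', -, -, hcold⟩ :=
    knob_member_doused_cold hX h0 hC hK hε hεK hρ hlo hhi
  intro t ht htt
  have hT0 : 0 ≤ T := by linarith only [hs1, hsT]
  have hTt' : T < t := lt_of_le_of_lt hTt htt
  have htI : t ∈ Icc T (T + 28282 / 10000) := ⟨hTt'.le, by linarith only [ht.2, hlow, hsT]⟩
  have hc : ∀ r ∈ Icc T (T + 28282 / 10000), X r 2 ≤ ρ ^ 2 / K ^ 9 := fun r hr =>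
    (hcold r hr).le
  have h := knob_drain_empties_transfer hX h0 hK0 hρ hT0 (by positivity) hc htI hTt'
  have hpos : 0 < t - (√(2 + 2 / K ^ 10) + 242 / K ^ 9) := sub_pos.2 htt
  have h1 : 1 / (K ^ 2 * (t - T) ^ 2)
      ≤ 1 / (K ^ 2 * (t - (√(2 + 2 / K ^ 10) + 242 / K ^ 9)) ^ 2) :=
    div_le_div_of_nonneg_left zero_le_one (mul_pos (pow_pos hK0 2) (pow_pos hpos 2))
      (mul_le_mul_of_nonneg_left
        (pow_le_pow_left₀ hpos.le (by linarith only [hTt]) 2) (pow_pos hK0 2).le)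
  have h2 : 2 * (ρ ^ 2 / K ^ 9 / ρ ^ 2 * (28282 / 10000)) ≤ 6 / K ^ 9 ∧
      3 * (ρ ^ 2 / K ^ 9 / ρ ^ 2 * (28282 / 10000)) ≤ 9 / K ^ 9 := by
    rw [show ρ ^ 2 / K ^ 9 / ρ ^ 2 = 1 / K ^ 9 by field_simp,
      show (6 : ℝ) / K ^ 9 = 6 * (1 / K ^ 9) by ring,
      show (9 : ℝ) / K ^ 9 = 9 * (1 / K ^ 9) by ring]
    have hK9 : 0 < 1 / K ^ 9 := by positivity
    constructor <;> linarith only [hK9]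
  -- part 39's lower bracket of `|d(T)|` feeds the frozen pair `E = d(T)² + ã(T)²`
  have hL2 : max (19951 / 20000 * |sin (ε / (K ^ 10 * ρ ^ 2) * π)|
      - 7 / 100 * |cos (ε / (K ^ 10 * ρ ^ 2) * π)| - 1 / 1000) 0 ^ 2 ≤ X T 3 ^ 2 := by
    have h3 := pow_le_pow_left₀ (le_max_right _ _) (max_le hd' (abs_nonneg _)) 2
    rwa [sq_abs] at h3
  exact ⟨by linarith only [h.1, h1, h2.1], by linarith only [h.2, h1, h2.2, hL2, sq_nonneg (X T 4)]⟩

/-! ## §130 A lattice dud re-lights with an empty transfer mode -/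

/-- **A LATTICE DUD RE-LIGHTS WITH AN EMPTY TRANSFER MODE.** Same hypotheses ON the lattice `ε =
kK¹⁰ρ²` (`k ∈ ℕ`): part 38's thirteen facts of `knob_dud_refires_sharp`, verbatim — the dousing
time `T ∈ [t₋, t₊]` with its six-digit clock, the clock zero `t_z ∈ [T + 1.414213, T + 1.4242]`,
`b ≤ 0`, `c ≤ 2ρ²/K¹⁰`, the clock slope and `a² ≥ 0.993` on `[T, t_z]`, the cold trigger `c <
ρ²/K⁹` on `[T, T + 2.8282]`, the re-light time `r₁ ∈ (T + 2.8282, T + 2.8542)` with `c(r₁) =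
ρ²/K⁹`, and `c ≤ ρ²/K⁹`, `b ≥ 0.993ε(r - t_z)`, `a² ≥ 0.993` on `[t_z, r₁]` — AND the new entry
datum `d(r₁)² ≤ 1/(7K²) + 6/K⁹`: §128 on `[T, r₁]` with `c₁ = ρ²/K⁹` (`2ρ²/K¹⁰ ≤ ρ²/K⁹` on `[T,
t_z]`), `(c₁/ρ²)(r₁ - T) ≤ 3/K⁹`, `(r₁ - T)² ≥ 2.8282² ≥ 7`. The transfer mode a lattice dud
brings into its second pulse is `≤ 0.378/K + 10⁻⁵` in modulus, not the bookkeeping `0.0837` of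
§127. [cite: Tao2016AveragedNS, §5.5 Theorem 5.3, (5.5), (5.6), (b-eq), (c-eq), (dora), (tcable)] -/
theorem knob_dud_relights_empty
    (hX : ∀ t, HasDerivAt X (RotorKnob.rotorCircuit K (K ^ 10) ε ρ (X t)) t)
    (h0 : X 0 = delayInit) (hC : ∀ t, HasDerivAt C (X t 2) t) (hK : 16 ≤ K) (hε : 0 < ε)
    (hεK : ε ^ 2 ≤ 1 / (6 * K ^ 20)) (hρ : 0 < ρ) (hlo : 200 * ε / K ^ 20 ≤ ρ ^ 2)
    (hhi : K ^ 10 * ρ ^ 2 ≤ 2 * ε) (k : ℕ) (hk : ε = k * K ^ 10 * ρ ^ 2) :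
    ∃ T tz r₁ : ℝ, √(2 - 24 * Real.log K / K ^ 10) ≤ T ∧ T ≤ √(2 + 2 / K ^ 10) + 242 / K ^ 9 ∧
      -(1414214 / 1000000 * ε) ≤ X T 1 ∧ X T 1 ≤ -(1414213 / 1000000 * ε) ∧
      T + 1414213 / 1000000 ≤ tz ∧ tz ≤ T + 14242 / 10000 ∧ X tz 1 = 0 ∧
      (∀ r ∈ Icc T tz, X r 1 ≤ 0 ∧ X r 2 ≤ 2 * ρ ^ 2 / K ^ 10 ∧
        X T 1 + 993 / 1000 * ε * (r - T) ≤ X r 1 ∧ 993 / 1000 ≤ X r 0 ^ 2) ∧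
      (∀ r ∈ Icc T (T + 28282 / 10000), X r 2 < ρ ^ 2 / K ^ 9) ∧
      T + 28282 / 10000 < r₁ ∧ r₁ < T + 28542 / 10000 ∧ X r₁ 2 = ρ ^ 2 / K ^ 9 ∧
      (∀ r ∈ Icc tz r₁, X r 2 ≤ ρ ^ 2 / K ^ 9 ∧ 993 / 1000 * ε * (r - tz) ≤ X r 1 ∧
        993 / 1000 ≤ X r 0 ^ 2) ∧
      X r₁ 3 ^ 2 ≤ 1 / (7 * K ^ 2) + 6 / K ^ 9 := by
  have hK0 : 0 < K := by linarith
  obtain ⟨T, tz, r₁, hT1, hT2, hb1, hb2, htz1, htz2, hbz, hP, hcw, hr1, hr2, hcr₁, hQ⟩ :=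
    knob_dud_refires_sharp hX h0 hC hK hε hεK hρ hlo hhi k hk
  have hT0 : 0 ≤ T := (Real.sqrt_nonneg _).trans hT1
  have h2K : 2 * ρ ^ 2 / K ^ 10 ≤ ρ ^ 2 / K ^ 9 := by
    rw [div_le_div_iff₀ (by positivity) (by positivity)]
    calc 2 * ρ ^ 2 * K ^ 9 ≤ K * ρ ^ 2 * K ^ 9 := by gcongr; linarith only [hK]
      _ = ρ ^ 2 * K ^ 10 := by ring
  have hc : ∀ r ∈ Icc T (T + (r₁ - T)), X r 2 ≤ ρ ^ 2 / K ^ 9 := by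
    intro r hr
    rcases le_total r tz with hrt | hrt
    · exact (hP r ⟨hr.1, hrt⟩).2.1.trans h2K
    · exact (hQ r ⟨hrt, by linarith only [hr.2]⟩).1
  have hTr : T < r₁ := by linarith only [hr1]
  have hrI : r₁ ∈ Icc T (T + (r₁ - T)) := ⟨hTr.le, by linarith only [hTr]⟩
  have h := knob_drain_empties_transfer hX h0 hK0 hρ hT0 (by positivity) hc hrI hTr
  have hd : (28282 : ℝ) / 10000 ≤ r₁ - T := by linarith only [hr1]
  have hd2 : (7 : ℝ) ≤ (r₁ - T) ^ 2 := by nlinarith [hd]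
  have h1 : 1 / (K ^ 2 * (r₁ - T) ^ 2) ≤ 1 / (7 * K ^ 2) := by
    refine div_le_div_of_nonneg_left zero_le_one (by positivity) ?_
    have h7 := mul_le_mul_of_nonneg_left hd2 (pow_pos hK0 2).le
    linarith only [h7]
  have h2 : 2 * (ρ ^ 2 / K ^ 9 / ρ ^ 2 * (r₁ - T)) ≤ 6 / K ^ 9 := by
    rw [show ρ ^ 2 / K ^ 9 / ρ ^ 2 = 1 / K ^ 9 by field_simp,
      show (6 : ℝ) / K ^ 9 = 6 * (1 / K ^ 9) by ring]
    have hK9 : 0 < 1 / K ^ 9 := by positivity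
    have hd3 : r₁ - T ≤ 3 := by linarith only [hr2]
    have h3 := mul_le_mul_of_nonneg_left hd3 hK9.le
    linarith only [h3, hK9]
  exact ⟨T, tz, r₁, hT1, hT2, hb1, hb2, htz1, htz2, hbz, hP, hcw, hr1, hr2, hcr₁, hQ,
    by linarith only [h, h1, h2]⟩

end Summit.NavierStokesRegularity.FluidComputer.GateBudget
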